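import Mathlib
import HarnessLib

/-!
# The EULER-FIELD INTEGRATION BY PARTS on a finite-dimensional space with a `C¹` density (analytic core of the virial identity (V2′) of
# memo2-24197-window, free-hands support of ⟨stmt-QuantumFields-24197⟩ `SwapVirialDeficit.SwapGluedStiffness`)

For a finite-dimensional real normed space `E` with an additive Haar measure `μ`, `n = finrank ℝ E`, a bounded `C¹` function `h` with bounded Euler derivative
`x ↦ Dh(x)·x`, and a `C¹` density `ρ` whose Euler divergence `n·ρ + Dρ(y)·y` is dominated, locally uniformly under dilations, by an integrable function:
* §1 `integral_comp_exp_smul`, ★ `integral_dilate_density` — the dilation identity `∫ h(eˢ·x)·ρ(x) dμ = e^{−n s}·∫ h(y)·ρ(e^{−s}·y) dμ` (exact change of variables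
  ✓`Measure.integral_comp_smul`);
* §2 ★★ `integral_euler_deriv_mul_eq` — differentiating both sides at `s = 0` (✓`hasDerivAt_integral_of_dominated_loc_of_deriv_le`, twice):
  `∫ (Dh(x)·x)·ρ(x) dμ = −∫ h(x)·(n·ρ(x) + Dρ(x)·x) dμ`.
Intended use (next files): `E = (ℝ³)^{letters}` (gnomonic coordinates of the ring, ✓`lintegral_haarProbability_su2_gnomonic`), `h = e^{−b F̂∘P}`,
`ρ = ∏ (1+|η_ℓ|²)⁻²`, where `n·ρ + Dρ·y = (2α − W)·ρ` with the explicit second-order weight `W = Σ 4|η_ℓ|²/(1+|η_ℓ|²)`: the VIRIAL IDENTITY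
`b⟨XF⟩_b = 2α − ⟨W⟩_b` of the memo, §2′.
HONEST LABEL: pure calculus (Mathlib only); nothing about Yang–Mills is proved here; ⟨24197⟩ stays OPEN; the Yang–Mills mass gap is NOT proved; no summit is
proved by a line.  Seat ym-line-fcl-p3 g45 (cell ym-idea-1, free hands; item of record ⟨24085⟩ aside, untouched), `--supports stmt-QuantumFields-24197`.
THEOREMS ONLY, 0 `sorry`, standard axioms.  References: [folklore] (Euler's identity ∕ virial by scaling).
-/

set_option autoImplicit false

noncomputable section

open MeasureTheory Set Filter Topology Module

namespace Summit.QuantumFields.YangMills.Theorems.SwapVirialDeficit.Virial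

variable {E : Type*} [NormedAddCommGroup E] [NormedSpace ℝ E] [MeasurableSpace E] [BorelSpace E] [FiniteDimensional ℝ E]
  (μ : Measure E) [μ.IsAddHaarMeasure]

/-! ## §1 The dilation identity -/

/-- Change of variables under the dilation `x ↦ eˢ·x`: `∫ k(eˢ·x) dμ = e^{−n s}·∫ k dμ`, `n = finrank ℝ E`. [folklore] -/
theorem integral_comp_exp_smul (k : E → ℝ) (s : ℝ) :
    ∫ x, k (Real.exp s • x) ∂μ = Real.exp (-((finrank ℝ E : ℝ) * s)) * ∫ y, k y ∂μ := by
  rw [Measure.integral_comp_smul μ k (Real.exp s), smul_eq_mul]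
  congr 1
  rw [abs_of_pos (inv_pos.2 (pow_pos (Real.exp_pos s) _)), ← Real.exp_nat_mul, ← Real.exp_neg]

/-- ★ **The dilation identity with a density**: `∫ h(eˢ·x)·ρ(x) dμ = e^{−n s}·∫ h(y)·ρ(e^{−s}·y) dμ`. [folklore] -/
theorem integral_dilate_density (h ρ : E → ℝ) (s : ℝ) :
    ∫ x, h (Real.exp s • x) * ρ x ∂μ = Real.exp (-((finrank ℝ E : ℝ) * s)) * ∫ y, h y * ρ (Real.exp (-s) • y) ∂μ := by
  have key := integral_comp_exp_smul μ (fun y => h y * ρ (Real.exp (-s) • y)) s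
  simp only [smul_smul, ← Real.exp_add, neg_add_cancel, Real.exp_zero, one_smul] at key
  exact key

/-! ## §2 Euler-field integration by parts -/

/-- ★★ **EULER-FIELD INTEGRATION BY PARTS.**  Let `h, ρ : E → ℝ` be `C¹`, `|h| ≤ B`, `|Dh(x)·x| ≤ B`, `ρ` integrable, and suppose the Euler derivative of
`ρ` is dominated locally uniformly under dilations: `|Dρ(e^{−s}y)·(e^{−s}y)| ≤ G(y)` for `|s| < 1`, `G` integrable.  Then
`∫ (Dh(x)·x)·ρ(x) dμ = −∫ h(x)·(n·ρ(x) + Dρ(x)·x) dμ`, `n = finrank ℝ E`. [folklore] -/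
theorem integral_euler_deriv_mul_eq (h ρ : E → ℝ) (hh : ContDiff ℝ 1 h) (hρ : ContDiff ℝ 1 ρ) {B : ℝ}
    (hB₁ : ∀ x, |h x| ≤ B) (hB₂ : ∀ x, |fderiv ℝ h x x| ≤ B) (hρi : Integrable ρ μ) {G : E → ℝ} (hGi : Integrable G μ)
    (hdom : ∀ s ∈ Ioo (-1 : ℝ) 1, ∀ y : E, |fderiv ℝ ρ (Real.exp (-s) • y) (Real.exp (-s) • y)| ≤ G y) :
    ∫ x, fderiv ℝ h x x * ρ x ∂μ = -∫ x, h x * ((finrank ℝ E : ℝ) * ρ x + fderiv ℝ ρ x x) ∂μ := by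
  set n : ℝ := (finrank ℝ E : ℝ) with hn
  have hhc : Continuous h := hh.continuous
  have hρc : Continuous ρ := hρ.continuous
  have hhd : ∀ x, HasFDerivAt h (fderiv ℝ h x) x := fun x => (hh.differentiable one_ne_zero x).hasFDerivAt
  have hρd : ∀ x, HasFDerivAt ρ (fderiv ℝ ρ x) x := fun x => (hρ.differentiable one_ne_zero x).hasFDerivAt
  have hfh : Continuous fun x => fderiv ℝ h x := hh.continuous_fderiv one_ne_zero
  have hfρ : Continuous fun x => fderiv ℝ ρ x := hρ.continuous_fderiv one_ne_zero
  have hs0 : Ioo (-1 : ℝ) 1 ∈ 𝓝 (0 : ℝ) := Ioo_mem_nhds (by norm_num) (by norm_num)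
  have h0mem : (0 : ℝ) ∈ Ioo (-1 : ℝ) 1 := ⟨by norm_num, by norm_num⟩
  -- integrability of the three products at `s = 0`
  have hint_hρ : Integrable (fun x => h x * ρ x) μ := by
    refine Integrable.mono' (hρi.norm.const_mul B) (hhc.mul hρc).aestronglyMeasurable (Eventually.of_forall fun x => ?_)
    rw [Real.norm_eq_abs, abs_mul, Real.norm_eq_abs]
    exact mul_le_mul_of_nonneg_right (hB₁ x) (abs_nonneg _)
  have hint_hDρ : Integrable (fun y => h y * fderiv ℝ ρ y y) μ := by
    refine Integrable.mono' (hGi.const_mul B) ((hhc.mul (hfρ.clm_apply continuous_id))).aestronglyMeasurable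
      (Eventually.of_forall fun y => ?_)
    rw [Real.norm_eq_abs, abs_mul]
    have := hdom 0 h0mem y
    simp only [neg_zero, Real.exp_zero, one_smul] at this
    exact mul_le_mul (hB₁ y) this (abs_nonneg _) (le_trans (abs_nonneg _) (hB₁ y))
  -- LEFT side `Φ(s) = ∫ h(eˢ x) ρ(x)`: derivative at 0 under the integral
  have hL : HasDerivAt (fun s : ℝ => ∫ x, h (Real.exp s • x) * ρ x ∂μ) (∫ x, fderiv ℝ h x x * ρ x ∂μ) 0 := by
    have key := hasDerivAt_integral_of_dominated_loc_of_deriv_le (μ := μ) (x₀ := (0 : ℝ)) (bound := fun x => B * ‖ρ x‖)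
      (F := fun (s : ℝ) (x : E) => h (Real.exp s • x) * ρ x)
      (F' := fun (s : ℝ) (x : E) => fderiv ℝ h (Real.exp s • x) (Real.exp s • x) * ρ x) hs0 ?_ ?_ ?_ ?_ ?_ ?_
    · simpa only [Real.exp_zero, one_smul] using key.2
    · exact Eventually.of_forall fun s =>
        ((hhc.comp (continuous_const.smul continuous_id)).mul hρc).aestronglyMeasurable
    · simpa only [Real.exp_zero, one_smul] using hint_hρ
    · simp only [Real.exp_zero, one_smul]
      exact ((hfh.clm_apply continuous_id).mul hρc).aestronglyMeasurable
    · refine Eventually.of_forall fun x s _ => ?_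
      rw [Real.norm_eq_abs, abs_mul, Real.norm_eq_abs]
      exact mul_le_mul_of_nonneg_right (hB₂ _) (abs_nonneg _)
    · exact hρi.norm.const_mul B
    · refine Eventually.of_forall fun x s _ => ?_
      have h1 : HasDerivAt (fun s : ℝ => Real.exp s • x) (Real.exp s • x) s := (Real.hasDerivAt_exp s).smul_const x
      have h2 : HasDerivAt (fun s : ℝ => h (Real.exp s • x)) (fderiv ℝ h (Real.exp s • x) (Real.exp s • x)) s :=
        (hhd _).comp_hasDerivAt s h1
      exact h2.mul_const (ρ x)
  -- the inner RIGHT integral `I(s) = ∫ h(y) ρ(e^{-s} y)`: derivative at 0 under the integral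
  have hI : HasDerivAt (fun s : ℝ => ∫ y, h y * ρ (Real.exp (-s) • y) ∂μ) (∫ y, -(h y * fderiv ℝ ρ y y) ∂μ) 0 := by
    have key := hasDerivAt_integral_of_dominated_loc_of_deriv_le (μ := μ) (x₀ := (0 : ℝ)) (bound := fun y => B * G y)
      (F := fun (s : ℝ) (y : E) => h y * ρ (Real.exp (-s) • y))
      (F' := fun (s : ℝ) (y : E) => -(h y * fderiv ℝ ρ (Real.exp (-s) • y) (Real.exp (-s) • y))) hs0 ?_ ?_ ?_ ?_ ?_ ?_
    · simpa only [neg_zero, Real.exp_zero, one_smul] using key.2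
    · exact Eventually.of_forall fun s =>
        (hhc.mul (hρc.comp (continuous_const.smul continuous_id))).aestronglyMeasurable
    · simpa only [neg_zero, Real.exp_zero, one_smul] using hint_hρ
    · simp only [neg_zero, Real.exp_zero, one_smul]
      exact (hhc.mul (hfρ.clm_apply continuous_id)).neg.aestronglyMeasurable
    · refine Eventually.of_forall fun y s hs => ?_
      rw [norm_neg, Real.norm_eq_abs, abs_mul]
      exact mul_le_mul (hB₁ y) (hdom s hs y) (abs_nonneg _) (le_trans (abs_nonneg _) (hB₁ y))
    · exact hGi.const_mul B
    · refine Eventually.of_forall fun y s _ => ?_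
      have h1 : HasDerivAt (fun s : ℝ => Real.exp (-s) • y) (-(Real.exp (-s)) • y) s := by
        have := ((Real.hasDerivAt_exp (-s)).comp s (hasDerivAt_neg s)).smul_const y
        simpa only [mul_neg, mul_one, neg_smul, Function.comp_def] using this
      have h2 : HasDerivAt (fun s : ℝ => ρ (Real.exp (-s) • y)) (fderiv ℝ ρ (Real.exp (-s) • y) (-(Real.exp (-s)) • y)) s :=
        (hρd _).comp_hasDerivAt s h1
      have h3 := h2.const_mul (h y)
      simpa only [neg_smul, map_neg, mul_neg] using h3
  -- the RIGHT side `Ψ(s) = e^{-ns} · I(s)`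
  have hE : HasDerivAt (fun s : ℝ => Real.exp (-(n * s))) (-n) 0 := by
    have h1 : HasDerivAt (fun s : ℝ => -(n * s)) (-n) 0 := by
      have := ((hasDerivAt_id (0 : ℝ)).const_mul n).neg
      simp only [Pi.neg_def, id, mul_one] at this
      exact this
    have h2 := (Real.hasDerivAt_exp (-(n * 0))).comp (0 : ℝ) h1
    simpa only [mul_zero, neg_zero, Real.exp_zero, one_mul, Function.comp_def] using h2
  have hR : HasDerivAt (fun s : ℝ => Real.exp (-(n * s)) * ∫ y, h y * ρ (Real.exp (-s) • y) ∂μ)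
      (-n * (∫ y, h y * ρ y ∂μ) + 1 * ∫ y, -(h y * fderiv ℝ ρ y y) ∂μ) 0 := by
    have := hE.mul hI
    simp only [Pi.mul_def, neg_zero, Real.exp_zero, one_smul, mul_zero] at this
    exact this
  -- `Φ = Ψ`, so the derivatives agree
  have hΦΨ : (fun s : ℝ => ∫ x, h (Real.exp s • x) * ρ x ∂μ) = fun s : ℝ => Real.exp (-(n * s)) * ∫ y, h y * ρ (Real.exp (-s) • y) ∂μ := by
    funext s
    exact integral_dilate_density μ h ρ s
  rw [hΦΨ] at hL
  have huniq := hL.unique hR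
  rw [huniq, integral_neg, one_mul]
  have e3 : ∫ x, h x * (n * ρ x + fderiv ℝ ρ x x) ∂μ = n * (∫ x, h x * ρ x ∂μ) + ∫ x, h x * fderiv ℝ ρ x x ∂μ := by
    have e4 : ∀ x, h x * (n * ρ x + fderiv ℝ ρ x x) = n * (h x * ρ x) + h x * fderiv ℝ ρ x x := fun x => by ring
    simp_rw [e4]
    rw [integral_add (hint_hρ.const_mul n) hint_hDρ, integral_const_mul]
  rw [e3]
  ring

end Summit.QuantumFields.YangMills.Theorems.SwapVirialDeficit.Virial

end
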